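import Mathlib.RingTheory.Localization.Algebra
import Mathlib.RingTheory.Localization.Away.Basic
import Mathlib.RingTheory.PolynomialAlgebra
import Mathlib.Algebra.Polynomial.AlgebraMap
import Mathlib.Algebra.Polynomial.Degree.Support
import Literature.AlgebraicGeometry.Resolution.AffineBlowupAlgebra
import Summits.ResolutionOfSingularities.ResolutionOfSingularities.Theorems.FrobeniusClosingPatchingRelPerfectDepthTaylorPolynomial
import HarnessLib

/-!
# Crux `PatchingRelPerfect` (stmt-ResolutionOfSingularities-16161), chain W5.2 — depth-`ℓ` programme beyond the graded case,
# GLUE G1: the `z`-chart of `Bl_{𝔷·B[t]+(t)} B[t]` is the polynomial ring over the `z`-chart of `Bl_𝔷 B` (lead prover, gen 4)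

[OURS · L1 W5.2 · lead] Replaces the role of NO printed item; NOT a statement of the manuscript under review.

The X-side retraction of the chain's depth-`ℓ` dictionary is chartwise an `𝔸¹`-bundle `Spec B[t] → Spec B` with the exceptional
divisor the zero section `t = 0`; a dictionary step blows up `Spec B[t]` along `V(𝔷) × {0}`, i.e. along `𝔷·B[t] + (t)`. This
file proves the RING-LEVEL CHART IDENTITY gluing the abstract coefficient flag (`…DepthTaylorFlag`) to the polynomial core
(`…DepthTaylorPolynomial`): `substStep f z′ : B[t] → B′[t′]`, `p ↦ (p.map f)(z′ t′)`, with `coeff_substStep` (the hypothesis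
`hφ` of `exists_eq_C_pow_mul_of_coeff`); `awayCEquiv z : B[t][1/z] ≃+* B[1/z][t]`; **`blowupAlgebraPolynomialEquiv 𝔷 z :
(B[𝔷/z])[t′] ≃+* B[t][(𝔷·B[t] + (t))/z]`** (`t′ ↦ t/z`; image models in `B[1/z][t′]`, `B[t][1/z]`) and
**`blowupAlgebraPolynomialEquiv_comp_substStep`**: composed with `substStep (B → B[𝔷/z]) z` it is the structure map of the chart —
«the `z`-chart of `Bl_{V(𝔷)×0}(Spec B × 𝔸¹)` is `Bl_{V(𝔷)}(Spec B)|_z × 𝔸¹` with coordinate `t′ = t/z`»; `blowupAlgebraPolynomialEquiv_spec`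
is the gen-3 spec G1 verbatim (its hypothesis `z ∈ 𝔷` is idle). Fact-free; AI-written, weaker than expert review. The scheme-level
glue (G2: sections of the abstract flag on a trivialising chart are the `coeffIdeal`s; G3: the chain's retractions are locally of
this form and stay so after a step) is a separate object.

References: The Stacks Project, Tags 0804, 052Q, 085S (charts `Spec A[I/a]`; blow-up and flat base change `B → B[t]`)
[StacksProject]; U. Görtz, T. Wedhorn, *Algebraic Geometry I*, 2nd ed. (2020), (13.19) p. 415, Prop. 13.91 [GortzWedhorn2020].
-/

-- `Summit.<Summit>.<Sub>.Theorems` with `Sub = Summit` (single-conjunct summit, D-0017)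
set_option linter.dupNamespace false

noncomputable section

open Polynomial IsLocalization Literature.AlgebraicGeometry.Resolution

namespace Summit.ResolutionOfSingularities.ResolutionOfSingularities.Theorems

universe u

namespace DepthGraded.Taylor

variable {B : Type u} [CommRing B]

/-! ## §1 The substitution `t ↦ z′·t′` over a base map -/

section Step

variable {B' : Type u} [CommRing B'] (f : B →+* B') (z' : B')

/-- [OURS · L1 W5.2 · lead] **The chart substitution** `substStep f z′ : B[t] → B′[t′]`, `p ↦ (p.map f)(z′ · t′)`: the
ring map of the `z`-chart of the blow-up of `Spec B[t]` along `V(𝔷) × {0}` over the base chart map `f : B → B′ = B[𝔷/z]`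
(`t = z′ t′`). [folklore] -/
def substStep : B[X] →+* B'[X] :=
  Polynomial.eval₂RingHom (Polynomial.C.comp f) (Polynomial.C z' * X)

/-- `substStep` on constants. [folklore] -/
@[simp] theorem substStep_C (b : B) : substStep f z' (Polynomial.C b) = Polynomial.C (f b) := by
  simp [substStep]

/-- `substStep` on the variable: `t ↦ z′ · t′`. [folklore] -/
@[simp] theorem substStep_X : substStep f z' (X : B[X]) = Polynomial.C z' * X := by
  simp [substStep]

/-- **Coefficients under the chart substitution**: `coeff_b ((p.map f)(z′ t′)) = z′^b · f (coeff_b p)` — the hypothesis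
`hφ` of `exists_eq_C_pow_mul_of_coeff` for the concrete chart map. [folklore] -/
theorem coeff_substStep (p : B[X]) (b : ℕ) : (substStep f z' p).coeff b = z' ^ b * f (p.coeff b) := by
  induction p using Polynomial.induction_on' with
  | add p q hp hq => rw [map_add, Polynomial.coeff_add, Polynomial.coeff_add, hp, hq, map_add, mul_add]
  | monomial n a =>
    rw [substStep, Polynomial.coe_eval₂RingHom, Polynomial.eval₂_monomial, RingHom.comp_apply, mul_pow,
      ← map_pow, ← mul_assoc, ← map_mul, Polynomial.coeff_C_mul_X_pow, Polynomial.coeff_monomial]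
    by_cases h : b = n
    · subst h; rw [if_pos rfl, if_pos rfl, mul_comm]
    · rw [if_neg h, if_neg (Ne.symm h), map_zero, mul_zero]

end Step

/-! ## §2 `B[t][1/z] ≅ B[1/z][t]` -/

section AwayC

variable (z : B)

/-- [OURS · L1 W5.2 · lead] **`B[t][1/z] ≃ B[1/z][t]`** as rings: `B[1/z][t]` is the localization of `B[t]` away from the
constant `z` (Mathlib's `Polynomial.isLocalization` for the `B[t]`-algebra structure `Polynomial.algebra`, used here only
inside the definition), whence the isomorphism of localizations; on `B[t]` it is `p ↦ p.map (B → B[1/z])`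
(`awayCEquiv_algebraMap`). [folklore] -/
def awayCEquiv : Localization.Away (Polynomial.C z : B[X]) ≃+* (Localization.Away z)[X] :=
  letI : Algebra B[X] (Localization.Away z)[X] := Polynomial.algebra B (Localization.Away z)
  haveI : IsLocalization.Away (Polynomial.C z : B[X]) (Localization.Away z)[X] := by
    have h := Polynomial.isLocalization (Submonoid.powers z) (Localization.Away z)
    rwa [Submonoid.map_powers] at h
  (IsLocalization.algEquiv (Submonoid.powers (Polynomial.C z : B[X])) (Localization.Away (Polynomial.C z : B[X]))
    ((Localization.Away z)[X])).toRingEquiv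

/-- `awayCEquiv` on `B[t]`: `p/1 ↦ p.map (B → B[1/z])`. [folklore] -/
theorem awayCEquiv_algebraMap (p : B[X]) :
    awayCEquiv z (algebraMap B[X] (Localization.Away (Polynomial.C z : B[X])) p) =
      p.map (algebraMap B (Localization.Away z)) := by
  letI : Algebra B[X] (Localization.Away z)[X] := Polynomial.algebra B (Localization.Away z)
  haveI : IsLocalization.Away (Polynomial.C z : B[X]) (Localization.Away z)[X] := by
    have h := Polynomial.isLocalization (Submonoid.powers z) (Localization.Away z)
    rwa [Submonoid.map_powers] at h
  change (IsLocalization.algEquiv (Submonoid.powers (Polynomial.C z : B[X]))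
    (Localization.Away (Polynomial.C z : B[X])) ((Localization.Away z)[X])) (algebraMap B[X] _ p) = _
  rw [AlgEquiv.commutes, Polynomial.algebraMap_def, Polynomial.coe_mapRingHom]

/-- `awayCEquiv⁻¹` on constants from `B`: `C (b/1) ↦ (C b)/1`. [folklore] -/
theorem awayCEquiv_symm_C_algebraMap (b : B) :
    (awayCEquiv z).symm (Polynomial.C (algebraMap B (Localization.Away z) b)) =
      algebraMap B[X] (Localization.Away (Polynomial.C z : B[X])) (Polynomial.C b) := by
  rw [RingEquiv.symm_apply_eq, awayCEquiv_algebraMap, Polynomial.map_C]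

/-- `awayCEquiv⁻¹` on the variable: `t ↦ t/1`. [folklore] -/
theorem awayCEquiv_symm_X :
    (awayCEquiv z).symm (X : (Localization.Away z)[X]) =
      algebraMap B[X] (Localization.Away (Polynomial.C z : B[X])) X := by
  rw [RingEquiv.symm_apply_eq, awayCEquiv_algebraMap, Polynomial.map_X]

/-- `awayCEquiv⁻¹` on the constant `1/z`: it is `1/z`. [folklore] -/
theorem awayCEquiv_symm_C_invSelf :
    (awayCEquiv z).symm (Polynomial.C (IsLocalization.Away.invSelf z)) =
      IsLocalization.Away.invSelf (Polynomial.C z : B[X]) := by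
  -- both are inverses of `(C z)/1`
  set w := (awayCEquiv z).symm (Polynomial.C (IsLocalization.Away.invSelf z)) with hw
  have h1 : w * algebraMap B[X] (Localization.Away (Polynomial.C z : B[X])) (Polynomial.C z) = 1 := by
    rw [hw, ← awayCEquiv_symm_C_algebraMap, ← map_mul, ← map_mul, mul_comm,
      IsLocalization.Away.mul_invSelf, map_one, map_one]
  have h2 := IsLocalization.Away.mul_invSelf (S := Localization.Away (Polynomial.C z : B[X])) (Polynomial.C z : B[X])
  calc w = w * (algebraMap B[X] (Localization.Away (Polynomial.C z : B[X])) (Polynomial.C z) *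
        IsLocalization.Away.invSelf (Polynomial.C z : B[X])) := by rw [h2, mul_one]
    _ = IsLocalization.Away.invSelf (Polynomial.C z : B[X]) := by rw [← mul_assoc, h1, one_mul]

/-- The rescaling automorphism `t ↦ t/z` of `B[1/z][t]` (inverse `t ↦ z t`). [folklore] -/
def rescaleEquiv : (Localization.Away z)[X] ≃ₐ[Localization.Away z] (Localization.Away z)[X] :=
  Polynomial.algEquivOfCompEqX (Polynomial.C (IsLocalization.Away.invSelf z) * X)
    (Polynomial.C (algebraMap B (Localization.Away z) z) * X)
    (by
      rw [Polynomial.mul_comp, Polynomial.C_comp, Polynomial.X_comp, ← mul_assoc, ← map_mul,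
        mul_comm (IsLocalization.Away.invSelf z) (algebraMap B (Localization.Away z) z),
        IsLocalization.Away.mul_invSelf, map_one, one_mul])
    (by
      rw [Polynomial.mul_comp, Polynomial.C_comp, Polynomial.X_comp, ← mul_assoc, ← map_mul,
        IsLocalization.Away.mul_invSelf, map_one, one_mul])

/-- `rescaleEquiv` on the variable: `t ↦ (1/z) · t`. [folklore] -/
theorem rescaleEquiv_X :
    rescaleEquiv z (X : (Localization.Away z)[X]) = Polynomial.C (IsLocalization.Away.invSelf z) * X := by
  rw [rescaleEquiv, Polynomial.algEquivOfCompEqX_apply, Polynomial.aeval_X]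

/-- `rescaleEquiv` fixes constants. [folklore] -/
theorem rescaleEquiv_C (x : Localization.Away z) :
    rescaleEquiv z (Polynomial.C x) = Polynomial.C x := by
  rw [Polynomial.C_eq_algebraMap, AlgEquiv.commutes]

end AwayC

/-! ## §3 The chart identity `(B[𝔷/z])[t′] ≅ B[t][(𝔷·B[t] + (t))/z]` -/

section Chart

variable (𝔷 : Ideal B) (z : B)

/-- The underlying ring map `(B[𝔷/z])[t′] → B[t][1/z]`: coefficients through `B[𝔷/z] ⊆ B[1/z]`, `t′ ↦ t/z`
(`= awayCEquiv⁻¹ ∘ rescaleEquiv ∘ map (B[𝔷/z] ⊆ B[1/z])`). [folklore] -/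
def blowupAlgebraPolynomialHom : (blowupAlgebra 𝔷 z)[X] →+* Localization.Away (Polynomial.C z : B[X]) :=
  (((rescaleEquiv z).toRingEquiv.trans (awayCEquiv z).symm).toRingHom).comp
    (Polynomial.mapRingHom ((blowupAlgebra 𝔷 z).val : blowupAlgebra 𝔷 z →+* Localization.Away z))

/-- The chart map is injective (a composite of `map` along the injection `B[𝔷/z] ⊆ B[1/z]` and two ring isomorphisms).
[folklore] -/
theorem blowupAlgebraPolynomialHom_injective : Function.Injective (blowupAlgebraPolynomialHom 𝔷 z) := by
  unfold blowupAlgebraPolynomialHom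
  rw [RingHom.coe_comp]
  exact (RingEquiv.injective _).comp (Polynomial.map_injective _ Subtype.val_injective)

/-- The chart map on constants: `C a ↦ awayCEquiv⁻¹ (C a)`. [folklore] -/
theorem blowupAlgebraPolynomialHom_C (a : blowupAlgebra 𝔷 z) :
    blowupAlgebraPolynomialHom 𝔷 z (Polynomial.C a) =
      (awayCEquiv z).symm (Polynomial.C (a : Localization.Away z)) := by
  simp only [blowupAlgebraPolynomialHom, RingHom.coe_comp, Function.comp_apply, Polynomial.coe_mapRingHom,
    Polynomial.map_C, RingEquiv.toRingHom_eq_coe, RingEquiv.coe_toRingHom, RingEquiv.coe_trans,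
    AlgEquiv.coe_ringEquiv]
  rw [show ((blowupAlgebra 𝔷 z).val : blowupAlgebra 𝔷 z →+* Localization.Away z) a = (a : Localization.Away z)
    from rfl, rescaleEquiv_C]

/-- The chart map on constants from `B`: `C b ↦ (C b)/1`. [folklore] -/
theorem blowupAlgebraPolynomialHom_C_algebraMap (b : B) :
    blowupAlgebraPolynomialHom 𝔷 z (Polynomial.C (algebraMap B (blowupAlgebra 𝔷 z) b)) =
      algebraMap B[X] (Localization.Away (Polynomial.C z : B[X])) (Polynomial.C b) := by
  rw [blowupAlgebraPolynomialHom_C, Subalgebra.coe_algebraMap, awayCEquiv_symm_C_algebraMap]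

/-- The chart map on the generators `c/z`, `c ∈ 𝔷`, of `B[𝔷/z]`: `C (c/z) ↦ (C c)/(C z)`. [folklore] -/
theorem blowupAlgebraPolynomialHom_C_div {c : B} (hc : c ∈ 𝔷) :
    blowupAlgebraPolynomialHom 𝔷 z
        (Polynomial.C ⟨algebraMap B (Localization.Away z) c * IsLocalization.Away.invSelf z,
          div_mem_blowupAlgebra 𝔷 z hc⟩) =
      algebraMap B[X] (Localization.Away (Polynomial.C z : B[X])) (Polynomial.C c) *
        IsLocalization.Away.invSelf (Polynomial.C z : B[X]) := by
  rw [blowupAlgebraPolynomialHom_C, Subtype.coe_mk, map_mul, map_mul, awayCEquiv_symm_C_algebraMap,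
    awayCEquiv_symm_C_invSelf]

/-- The chart map on the variable: `t′ ↦ t/z = (1/z) · t`. [folklore] -/
theorem blowupAlgebraPolynomialHom_X :
    blowupAlgebraPolynomialHom 𝔷 z X =
      IsLocalization.Away.invSelf (Polynomial.C z : B[X]) *
        algebraMap B[X] (Localization.Away (Polynomial.C z : B[X])) X := by
  simp only [blowupAlgebraPolynomialHom, RingHom.coe_comp, Function.comp_apply, Polynomial.coe_mapRingHom,
    Polynomial.map_X, RingEquiv.toRingHom_eq_coe, RingEquiv.coe_toRingHom, RingEquiv.coe_trans,
    AlgEquiv.coe_ringEquiv]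
  rw [rescaleEquiv_X, map_mul, awayCEquiv_symm_C_invSelf, awayCEquiv_symm_X]

/-- **The chart map after the substitution is the structure map**: `Φ ((p.map (B → B[𝔷/z]))(z t′)) = p/1` for every
`p ∈ B[t]` (`t = z · (t/z)`). [folklore] -/
theorem blowupAlgebraPolynomialHom_comp_substStep :
    (blowupAlgebraPolynomialHom 𝔷 z).comp
        (substStep (algebraMap B (blowupAlgebra 𝔷 z)) (algebraMap B (blowupAlgebra 𝔷 z) z)) =
      algebraMap B[X] (Localization.Away (Polynomial.C z : B[X])) := by
  refine Polynomial.ringHom_ext (fun b => ?_) ?_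
  · rw [RingHom.comp_apply, substStep_C, blowupAlgebraPolynomialHom_C_algebraMap]
  · rw [RingHom.comp_apply, substStep_X, map_mul, blowupAlgebraPolynomialHom_C_algebraMap,
      blowupAlgebraPolynomialHom_X, ← mul_assoc, IsLocalization.Away.mul_invSelf, one_mul]

/-- **Range, first half**: the chart map lands in `B[t][(𝔷·B[t] + (t))/z]`. [folklore] -/
theorem blowupAlgebraPolynomialHom_mem (p : (blowupAlgebra 𝔷 z)[X]) :
    blowupAlgebraPolynomialHom 𝔷 z p ∈
      blowupAlgebra (𝔷.map (Polynomial.C : B →+* B[X]) ⊔ Ideal.span {(X : B[X])}) (Polynomial.C z) := by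
  set S' := blowupAlgebra (𝔷.map (Polynomial.C : B →+* B[X]) ⊔ Ideal.span {(X : B[X])}) (Polynomial.C z) with hS'
  have hXI : (X : B[X]) ∈ 𝔷.map (Polynomial.C : B →+* B[X]) ⊔ Ideal.span {(X : B[X])} :=
    Ideal.mem_sup_right (Ideal.mem_span_singleton_self _)
  -- constants
  have hC : ∀ a : blowupAlgebra 𝔷 z, blowupAlgebraPolynomialHom 𝔷 z (Polynomial.C a) ∈ S' := by
    rintro ⟨a, ha⟩
    rw [blowupAlgebraPolynomialHom_C, Subtype.coe_mk]
    refine Algebra.adjoin_induction (p := fun x _ => (awayCEquiv z).symm (Polynomial.C x) ∈ S')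
      ?_ ?_ ?_ ?_ ha
    · rintro _ ⟨c, hc, rfl⟩
      rw [map_mul, map_mul, awayCEquiv_symm_C_algebraMap, awayCEquiv_symm_C_invSelf]
      exact div_mem_blowupAlgebra _ _ (Ideal.mem_sup_left (Ideal.mem_map_of_mem _ hc))
    · intro b; rw [awayCEquiv_symm_C_algebraMap]; exact Subalgebra.algebraMap_mem _ _
    · intro x y _ _ hx hy; rw [map_add, map_add]; exact Subalgebra.add_mem _ hx hy
    · intro x y _ _ hx hy; rw [map_mul, map_mul]; exact Subalgebra.mul_mem _ hx hy
  -- the variable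
  have hX : blowupAlgebraPolynomialHom 𝔷 z X ∈ S' := by
    rw [blowupAlgebraPolynomialHom_X, mul_comm]
    exact div_mem_blowupAlgebra _ _ hXI
  rw [p.as_sum_support_C_mul_X_pow, map_sum]
  refine Subalgebra.sum_mem _ fun n _ => ?_
  rw [map_mul, map_pow]
  exact Subalgebra.mul_mem _ (hC _) (Subalgebra.pow_mem _ hX n)

/-- **Range**: the image of the chart map IS `B[t][(𝔷·B[t] + (t))/z]` (the latter is generated over `B[t]` by the
`(C c)/(C z)`, `c ∈ 𝔷`, and `t/(C z)`, all in the image, and the image contains `B[t]` by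
`blowupAlgebraPolynomialHom_comp_substStep`). [cite: StacksProject, Tag 0804] -/
theorem range_blowupAlgebraPolynomialHom :
    Set.range (blowupAlgebraPolynomialHom 𝔷 z) =
      (blowupAlgebra (𝔷.map (Polynomial.C : B →+* B[X]) ⊔ Ideal.span {(X : B[X])}) (Polynomial.C z) :
        Set (Localization.Away (Polynomial.C z : B[X]))) := by
  apply le_antisymm
  · rintro _ ⟨p, rfl⟩
    exact blowupAlgebraPolynomialHom_mem 𝔷 z p
  · -- the range is a `B[t]`-subalgebra
    let T : Subalgebra B[X] (Localization.Away (Polynomial.C z : B[X])) :=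
      { carrier := Set.range (blowupAlgebraPolynomialHom 𝔷 z)
        mul_mem' := by rintro _ _ ⟨p, rfl⟩ ⟨q, rfl⟩; exact ⟨p * q, map_mul _ _ _⟩
        one_mem' := ⟨1, map_one _⟩
        add_mem' := by rintro _ _ ⟨p, rfl⟩ ⟨q, rfl⟩; exact ⟨p + q, map_add _ _ _⟩
        zero_mem' := ⟨0, map_zero _⟩
        algebraMap_mem' := fun q =>
          ⟨substStep (algebraMap B (blowupAlgebra 𝔷 z)) (algebraMap B (blowupAlgebra 𝔷 z) z) q, by
            rw [← RingHom.comp_apply, blowupAlgebraPolynomialHom_comp_substStep]⟩ }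
    change blowupAlgebra _ _ ≤ T
    -- the set of `y ∈ B[t]` with `y/(C z)` in the range is an ideal containing `𝔷·B[t] + (t)`
    let lin : B[X] →ₗ[B[X]] Localization.Away (Polynomial.C z : B[X]) :=
      (LinearMap.mulRight B[X] (IsLocalization.Away.invSelf (Polynomial.C z : B[X]))).comp
        (Algebra.linearMap B[X] (Localization.Away (Polynomial.C z : B[X])))
    let J₀ : Ideal B[X] := Submodule.comap lin (Subalgebra.toSubmodule T)
    have hJ₀ : ∀ y : B[X], y ∈ J₀ ↔ algebraMap B[X] (Localization.Away (Polynomial.C z : B[X])) y *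
        IsLocalization.Away.invSelf (Polynomial.C z : B[X]) ∈ Set.range (blowupAlgebraPolynomialHom 𝔷 z) :=
      fun y => Iff.rfl
    have hle : 𝔷.map (Polynomial.C : B →+* B[X]) ⊔ Ideal.span {(X : B[X])} ≤ J₀ := by
      refine sup_le ?_ ?_
      · rw [Ideal.map_le_iff_le_comap]
        exact fun c hc => (hJ₀ _).mpr ⟨_, blowupAlgebraPolynomialHom_C_div 𝔷 z hc⟩
      · rw [Ideal.span_le, Set.singleton_subset_iff, SetLike.mem_coe, hJ₀]
        exact ⟨X, by rw [blowupAlgebraPolynomialHom_X, mul_comm]⟩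
    refine Algebra.adjoin_le ?_
    rintro _ ⟨y, hy, rfl⟩
    exact (hJ₀ y).mp (hle hy)

/-- [OURS · L1 W5.2 · lead] **GLUE G1 — the chart identity `(B[𝔷/z])[t′] ≅ B[t][(𝔷·B[t] + (t))/z]`.** The `z`-chart of
the blow-up of `B[t]` along `𝔷·B[t] + (t)` (the centre `V(𝔷) × {0} ⊂ Spec B × 𝔸¹`) is the polynomial ring over the
`z`-chart `B[𝔷/z]` of the blow-up of `B` along `𝔷`, the new variable being `t′ = t/z` (image models inside `B[1/z][t′]` and
`B[t][1/z]`). Ring-level form of «blowing up commutes with the flat base change `B → B[t]`» combined with the `t`-direction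
of the centre. [cite: StacksProject, Tag 0804] [cite: GortzWedhorn2020, (13.19) p. 415] -/
def blowupAlgebraPolynomialEquiv :
    (blowupAlgebra 𝔷 z)[X] ≃+*
      blowupAlgebra (𝔷.map (Polynomial.C : B →+* B[X]) ⊔ Ideal.span {(X : B[X])}) (Polynomial.C z) :=
  RingEquiv.ofBijective
    ((blowupAlgebraPolynomialHom 𝔷 z).codRestrict
      (blowupAlgebra (𝔷.map (Polynomial.C : B →+* B[X]) ⊔ Ideal.span {(X : B[X])}) (Polynomial.C z)).toSubring
      (blowupAlgebraPolynomialHom_mem 𝔷 z))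
    ⟨fun p q h => blowupAlgebraPolynomialHom_injective 𝔷 z (congrArg Subtype.val h), fun y => by
      obtain ⟨p, hp⟩ : (y : Localization.Away (Polynomial.C z : B[X])) ∈ Set.range (blowupAlgebraPolynomialHom 𝔷 z) := by
        rw [range_blowupAlgebraPolynomialHom 𝔷 z]; exact y.2
      exact ⟨p, Subtype.ext hp⟩⟩

/-- The isomorphism is the chart map. [folklore] -/
@[simp] theorem coe_blowupAlgebraPolynomialEquiv (p : (blowupAlgebra 𝔷 z)[X]) :
    (blowupAlgebraPolynomialEquiv 𝔷 z p : Localization.Away (Polynomial.C z : B[X])) =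
      blowupAlgebraPolynomialHom 𝔷 z p :=
  rfl

/-- `Φ` on constants from `B`: `C b ↦ (C b)/1`. [folklore] -/
theorem coe_blowupAlgebraPolynomialEquiv_C_algebraMap (b : B) :
    (blowupAlgebraPolynomialEquiv 𝔷 z (Polynomial.C (algebraMap B (blowupAlgebra 𝔷 z) b)) :
        Localization.Away (Polynomial.C z : B[X])) =
      algebraMap B[X] (Localization.Away (Polynomial.C z : B[X])) (Polynomial.C b) :=
  blowupAlgebraPolynomialHom_C_algebraMap 𝔷 z b

/-- `Φ` on the generators of `B[𝔷/z]`: `C (c/z) ↦ (C c)/(C z)`. [folklore] -/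
theorem coe_blowupAlgebraPolynomialEquiv_C_div {c : B} (hc : c ∈ 𝔷) :
    (blowupAlgebraPolynomialEquiv 𝔷 z
        (Polynomial.C ⟨algebraMap B (Localization.Away z) c * IsLocalization.Away.invSelf z,
          div_mem_blowupAlgebra 𝔷 z hc⟩) : Localization.Away (Polynomial.C z : B[X])) =
      algebraMap B[X] (Localization.Away (Polynomial.C z : B[X])) (Polynomial.C c) *
        IsLocalization.Away.invSelf (Polynomial.C z : B[X]) :=
  blowupAlgebraPolynomialHom_C_div 𝔷 z hc

/-- `Φ` on the variable: `t′ ↦ t/z`, i.e. `Φ(t′) · (C z) = t`. [folklore] -/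
theorem coe_blowupAlgebraPolynomialEquiv_X_mul :
    (blowupAlgebraPolynomialEquiv 𝔷 z X : Localization.Away (Polynomial.C z : B[X])) *
        algebraMap B[X] (Localization.Away (Polynomial.C z : B[X])) (Polynomial.C z) =
      algebraMap B[X] (Localization.Away (Polynomial.C z : B[X])) X := by
  rw [coe_blowupAlgebraPolynomialEquiv, blowupAlgebraPolynomialHom_X, mul_comm, ← mul_assoc,
    IsLocalization.Away.mul_invSelf, one_mul]

/-- **`Φ ∘ substStep = structure map`**: for `p ∈ B[t]`, `Φ ((p.map (B → B[𝔷/z]))(z t′)) = p/1` in `B[t][1/z]` — the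
chart map of `Bl_{V(𝔷)×0} (Spec B[t]) → Spec B[t]` on the `z`-chart is `substStep` followed by `Φ`. [cite: StacksProject, Tag 0804] -/
theorem coe_blowupAlgebraPolynomialEquiv_substStep (p : B[X]) :
    (blowupAlgebraPolynomialEquiv 𝔷 z
        (substStep (algebraMap B (blowupAlgebra 𝔷 z)) (algebraMap B (blowupAlgebra 𝔷 z) z) p) :
        Localization.Away (Polynomial.C z : B[X])) =
      algebraMap B[X] (Localization.Away (Polynomial.C z : B[X])) p := by
  rw [coe_blowupAlgebraPolynomialEquiv, ← RingHom.comp_apply, blowupAlgebraPolynomialHom_comp_substStep]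

/-- As ring maps into the chart algebra: `Φ ∘ substStep = algebraMap B[t] B[t][(𝔷·B[t] + (t))/z]`. [cite: StacksProject, Tag 0804] -/
theorem blowupAlgebraPolynomialEquiv_comp_substStep :
    (blowupAlgebraPolynomialEquiv 𝔷 z).toRingHom.comp
        (substStep (algebraMap B (blowupAlgebra 𝔷 z)) (algebraMap B (blowupAlgebra 𝔷 z) z)) =
      algebraMap B[X]
        (blowupAlgebra (𝔷.map (Polynomial.C : B →+* B[X]) ⊔ Ideal.span {(X : B[X])}) (Polynomial.C z)) := by
  refine RingHom.ext fun p => Subtype.ext ?_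
  rw [RingHom.comp_apply, RingEquiv.toRingHom_eq_coe, RingEquiv.coe_toRingHom,
    coe_blowupAlgebraPolynomialEquiv_substStep, Subalgebra.coe_algebraMap]

/-- `Φ` on a general constant `C a`, `a ∈ B[𝔷/z] ⊆ B[1/z]`: it is the canonical map `B[1/z] → B[t][1/z]` applied to `a`.
[folklore] -/
theorem coe_blowupAlgebraPolynomialEquiv_C (a : blowupAlgebra 𝔷 z) :
    (blowupAlgebraPolynomialEquiv 𝔷 z (Polynomial.C a) : Localization.Away (Polynomial.C z : B[X])) =
      IsLocalization.Away.map (Localization.Away z) (Localization.Away (Polynomial.C z : B[X]))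
        (Polynomial.C : B →+* B[X]) z (a : Localization.Away z) := by
  rw [coe_blowupAlgebraPolynomialEquiv, blowupAlgebraPolynomialHom_C]
  -- two ring maps `B[1/z] → B[t][1/z]` agreeing on `B`
  have key : ((awayCEquiv z).symm.toRingHom.comp (Polynomial.C : Localization.Away z →+* (Localization.Away z)[X])) =
      IsLocalization.Away.map (Localization.Away z) (Localization.Away (Polynomial.C z : B[X]))
        (Polynomial.C : B →+* B[X]) z := by
    refine IsLocalization.ringHom_ext (Submonoid.powers z) ?_
    ext b
    rw [RingHom.comp_apply, RingHom.comp_apply, RingEquiv.toRingHom_eq_coe, RingEquiv.coe_toRingHom,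
      awayCEquiv_symm_C_algebraMap, RingHom.comp_apply, IsLocalization.Away.map, IsLocalization.map_eq]
  rw [← key, RingHom.comp_apply, RingEquiv.toRingHom_eq_coe, RingEquiv.coe_toRingHom]

/-- [OURS · L1 W5.2 · lead] **G1 in the exact form of the gen-3 spec** (`FilteredGlueSpec.blowupAlgebraPolynomialEquiv_spec`,
there with the idle hypothesis `z ∈ 𝔷`): there is a ring isomorphism `Φ : (B[𝔷/z])[t′] ≃ B[t][(𝔷·B[t] + (t))/z]` with
`Φ (C b) = (C b)/1` for `b ∈ B` and `Φ(t′) · (C z)/1 = t/1`. [cite: StacksProject, Tag 0804] -/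
theorem blowupAlgebraPolynomialEquiv_spec :
    ∃ Φ : Polynomial (blowupAlgebra 𝔷 z) ≃+*
        blowupAlgebra (𝔷.map (Polynomial.C : B →+* B[X]) ⊔ Ideal.span {X}) (Polynomial.C z),
      (∀ b : B, (Φ (Polynomial.C (algebraMap B (blowupAlgebra 𝔷 z) b)) :
          Localization.Away (Polynomial.C z : B[X])) =
        algebraMap B[X] (Localization.Away (Polynomial.C z : B[X])) (Polynomial.C b)) ∧
      ((Φ X : Localization.Away (Polynomial.C z : B[X])) * algebraMap B[X] _ (Polynomial.C z) =
        algebraMap B[X] (Localization.Away (Polynomial.C z : B[X])) X) :=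
  ⟨blowupAlgebraPolynomialEquiv 𝔷 z, coe_blowupAlgebraPolynomialEquiv_C_algebraMap 𝔷 z,
    coe_blowupAlgebraPolynomialEquiv_X_mul 𝔷 z⟩

end Chart

end DepthGraded.Taylor

end Summit.ResolutionOfSingularities.ResolutionOfSingularities.Theorems

end
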